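import Summits.QuantumAdvantage.QuantumAdvantage.Theorems.TwoSquaresLadderTwoSquaresFloorDivisors
import Literature.NumberTheory.Sieve.FriedlanderIwaniecPrimesLemma51

/-!
# Route `TwoSquaresLadder`, support `TwoSquaresFloor` (stmt-QuantumAdvantage-16062), part 2: the theorem

`#(S₂ ∩ [2^{n−1}, 2ⁿ)) ≥ 2ⁿ/(3072 n³)` for `n ≥ 8`: a dyadic box `B` of lattice points of size exactly `2ⁿ/32` inside
`{(u,v) : 2^{n−1} ≤ u² + v² < 2ⁿ}` (parity split on `n`, no square roots), Cauchy–Schwarz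
`#B² ≤ #(image) · #(collisions)`, collisions `≤ #B + 2 Σ_{m ≤ 2ⁿ} τ(m)²` (difference-of-squares injection into
divisors), and `Σ τ² ≤ X H_X³ ≤ X n³` from part 1 (`TwoSquaresLadderTwoSquaresFloorDivisors.lean`, which has the full
sketch and references; `H_X ≤ 1 + log X` is the tree's `FriedlanderIwaniecPrimes.sum_Icc_one_div_le`).

HONEST FRAMING: a closed ledger item (an elementary counting lemma, kernel-checked), NOT summit progress.
-/

set_option linter.dupNamespace false -- D-0017: single-problem summit ⇒ `QuantumAdvantage.QuantumAdvantage` by design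

namespace Summit.QuantumAdvantage.QuantumAdvantage.Theorems.TwoSquaresFloor

open Finset

/-! ### Collisions of `(u, v) ↦ u² + v²` on a finite set of lattice points -/

/-- CAUCHY–SCHWARZ: `#B² ≤ #{u²+v² : (u,v) ∈ B} · #{collisions}`, collisions = pairs of points of `B` with the same
`u² + v²`. [folklore] -/
theorem card_sq_le_image_mul_coll (B : Finset (ℕ × ℕ)) :
    ((B.card : ℝ)) ^ 2 ≤ ((B.image fun b : ℕ × ℕ => b.1 ^ 2 + b.2 ^ 2).card : ℝ) *
      (((B ×ˢ B).filter fun q : (ℕ × ℕ) × (ℕ × ℕ) =>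
        q.1.1 ^ 2 + q.1.2 ^ 2 = q.2.1 ^ 2 + q.2.2 ^ 2).card : ℝ) := by
  classical
  set f : ℕ × ℕ → ℕ := fun b => b.1 ^ 2 + b.2 ^ 2 with hf
  set A := B.image f with hA
  have hfib : (B.card : ℝ) = ∑ N ∈ A, ((B.filter fun b => f b = N).card : ℝ) := by
    rw [Finset.card_eq_sum_card_fiberwise (fun b hb => Finset.mem_image_of_mem f hb)]
    push_cast
    rfl
  have hcoll : (((B ×ˢ B).filter fun q : (ℕ × ℕ) × (ℕ × ℕ) =>
      q.1.1 ^ 2 + q.1.2 ^ 2 = q.2.1 ^ 2 + q.2.2 ^ 2).card : ℝ) =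
      ∑ N ∈ A, ((B.filter fun b => f b = N).card : ℝ) ^ 2 := by
    rw [Finset.card_eq_sum_card_fiberwise (f := fun q : (ℕ × ℕ) × (ℕ × ℕ) => f q.1) (t := A)
      (fun q hq => Finset.mem_image_of_mem f (Finset.mem_product.1 (Finset.mem_filter.1 hq).1).1)]
    push_cast
    refine Finset.sum_congr rfl fun N _ => ?_
    rw [sq, ← Nat.cast_mul, ← Finset.card_product]
    congr 2
    ext ⟨b, b'⟩
    simp only [Finset.mem_filter, Finset.mem_product, hf]
    constructor
    · rintro ⟨⟨⟨hb, hb'⟩, he⟩, hN⟩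
      exact ⟨⟨hb, hN⟩, hb', by rw [← he, hN]⟩
    · rintro ⟨⟨hb, hN⟩, hb', hN'⟩
      exact ⟨⟨⟨hb, hb'⟩, by rw [hN, hN']⟩, hN⟩
  rw [hfib, hcoll]
  exact sq_sum_le_card_mul_sum_sq

/-- Collisions with equal first coordinates are diagonal: `≤ #B` of them. [folklore] -/
theorem card_coll_eq_le (B : Finset (ℕ × ℕ)) :
    ((((B ×ˢ B).filter fun q : (ℕ × ℕ) × (ℕ × ℕ) =>
        q.1.1 ^ 2 + q.1.2 ^ 2 = q.2.1 ^ 2 + q.2.2 ^ 2)).filter fun q => q.1.1 = q.2.1).card ≤ B.card := by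
  refine Finset.card_le_card_of_injOn (fun q => q.1) (fun q hq => ?_) ?_
  · rw [Finset.mem_coe, Finset.mem_filter, Finset.mem_filter, Finset.mem_product] at hq
    rw [Finset.mem_coe]
    exact hq.1.1.1
  · rintro ⟨b, b'⟩ hq ⟨c, c'⟩ hq' h
    rw [Finset.mem_coe, Finset.mem_filter, Finset.mem_filter, Finset.mem_product] at hq hq'
    simp only at h hq hq'
    obtain ⟨⟨_, he⟩, hu⟩ := hq
    obtain ⟨⟨_, he'⟩, hu'⟩ := hq'
    subst h
    have hv : b.2 = b'.2 := by
      have : b.2 ^ 2 = b'.2 ^ 2 := by rw [hu] at he; omega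
      exact Nat.pow_left_injective two_ne_zero this
    have hv' : b.2 = c'.2 := by
      have : b.2 ^ 2 = c'.2 ^ 2 := by rw [hu'] at he'; omega
      exact Nat.pow_left_injective two_ne_zero this
    have e1 : b' = b := Prod.ext hu.symm hv.symm
    have e2 : c' = b := Prod.ext hu'.symm hv'.symm
    rw [e1, e2]

/-- Collisions with `u > u'` inject into pairs of difference-of-squares representations
`((u,v),(u',v')) ↦ (m = u² − u'², (u,u'), (v',v))`, so there are `≤ Σ_{m ≤ X} τ(m)²` of them when the points of `B`
have coordinates `< X` and `u² ≤ X`. [folklore] -/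
theorem card_coll_gt_le (B : Finset (ℕ × ℕ)) (X : ℕ) (hB : ∀ b ∈ B, b.1 < X ∧ b.2 < X ∧ b.1 ^ 2 ≤ X) :
    ((((B ×ˢ B).filter fun q : (ℕ × ℕ) × (ℕ × ℕ) =>
        q.1.1 ^ 2 + q.1.2 ^ 2 = q.2.1 ^ 2 + q.2.2 ^ 2)).filter fun q => q.2.1 < q.1.1).card ≤
      ∑ m ∈ Icc 1 X, m.divisors.card ^ 2 := by
  classical
  set D : ℕ → Finset (ℕ × ℕ) := fun m =>
    (Finset.range X ×ˢ Finset.range X).filter fun ac : ℕ × ℕ => ac.2 < ac.1 ∧ ac.1 ^ 2 - ac.2 ^ 2 = m with hD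
  set S := (Icc 1 X).sigma fun m => D m ×ˢ D m with hS
  have hS_card : S.card ≤ ∑ m ∈ Icc 1 X, m.divisors.card ^ 2 := by
    rw [hS, Finset.card_sigma]
    refine Finset.sum_le_sum fun m hm => ?_
    rw [Finset.mem_Icc] at hm
    rw [Finset.card_product, sq]
    exact Nat.mul_le_mul (card_diffSq_le X m (by omega)) (card_diffSq_le X m (by omega))
  refine le_trans ?_ hS_card
  refine Finset.card_le_card_of_injOn
    (fun q => (⟨q.1.1 ^ 2 - q.2.1 ^ 2, ((q.1.1, q.2.1), (q.2.2, q.1.2))⟩ : Σ _ : ℕ, (ℕ × ℕ) × (ℕ × ℕ)))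
    (fun q hq => ?_) ?_
  · rw [Finset.mem_coe, Finset.mem_filter, Finset.mem_filter, Finset.mem_product] at hq
    obtain ⟨⟨⟨hb, hb'⟩, he⟩, hlt⟩ := hq
    obtain ⟨hu, hv, hu2⟩ := hB _ hb
    obtain ⟨hu', hv', _⟩ := hB _ hb'
    have hlt2 : q.2.1 ^ 2 < q.1.1 ^ 2 := Nat.pow_lt_pow_left hlt two_ne_zero
    have hvv : q.1.2 < q.2.2 := by
      by_contra hle
      have : q.2.2 ^ 2 ≤ q.1.2 ^ 2 := Nat.pow_le_pow_left (not_lt.1 hle) 2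
      omega
    rw [Finset.mem_coe]
    simp only [hS, hD, Finset.mem_sigma, Finset.mem_Icc, Finset.mem_product, Finset.mem_filter,
      Finset.mem_range]
    refine ⟨⟨by omega, by omega⟩, ⟨⟨hu, hu'⟩, hlt, by trivial⟩, ⟨⟨hv', hv⟩, hvv, by omega⟩⟩
  · rintro ⟨⟨u, v⟩, ⟨u', v'⟩⟩ _ ⟨⟨w, z⟩, ⟨w', z'⟩⟩ _ h
    simp only [Sigma.mk.injEq, heq_eq_eq, Prod.mk.injEq] at h
    obtain ⟨_, ⟨rfl, rfl⟩, rfl, rfl⟩ := h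
    rfl

/-- … and symmetrically for `u < u'`. [folklore] -/
theorem card_coll_lt_le (B : Finset (ℕ × ℕ)) (X : ℕ) (hB : ∀ b ∈ B, b.1 < X ∧ b.2 < X ∧ b.1 ^ 2 ≤ X) :
    ((((B ×ˢ B).filter fun q : (ℕ × ℕ) × (ℕ × ℕ) =>
        q.1.1 ^ 2 + q.1.2 ^ 2 = q.2.1 ^ 2 + q.2.2 ^ 2)).filter fun q => q.1.1 < q.2.1).card ≤
      ∑ m ∈ Icc 1 X, m.divisors.card ^ 2 := by
  classical
  set D : ℕ → Finset (ℕ × ℕ) := fun m =>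
    (Finset.range X ×ˢ Finset.range X).filter fun ac : ℕ × ℕ => ac.2 < ac.1 ∧ ac.1 ^ 2 - ac.2 ^ 2 = m with hD
  set S := (Icc 1 X).sigma fun m => D m ×ˢ D m with hS
  have hS_card : S.card ≤ ∑ m ∈ Icc 1 X, m.divisors.card ^ 2 := by
    rw [hS, Finset.card_sigma]
    refine Finset.sum_le_sum fun m hm => ?_
    rw [Finset.mem_Icc] at hm
    rw [Finset.card_product, sq]
    exact Nat.mul_le_mul (card_diffSq_le X m (by omega)) (card_diffSq_le X m (by omega))
  refine le_trans ?_ hS_card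
  refine Finset.card_le_card_of_injOn
    (fun q => (⟨q.2.1 ^ 2 - q.1.1 ^ 2, ((q.2.1, q.1.1), (q.1.2, q.2.2))⟩ : Σ _ : ℕ, (ℕ × ℕ) × (ℕ × ℕ)))
    (fun q hq => ?_) ?_
  · rw [Finset.mem_coe, Finset.mem_filter, Finset.mem_filter, Finset.mem_product] at hq
    obtain ⟨⟨⟨hb, hb'⟩, he⟩, hlt⟩ := hq
    obtain ⟨hu, hv, _⟩ := hB _ hb
    obtain ⟨hu', hv', hu2'⟩ := hB _ hb'
    have hlt2 : q.1.1 ^ 2 < q.2.1 ^ 2 := Nat.pow_lt_pow_left hlt two_ne_zero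
    have hvv : q.2.2 < q.1.2 := by
      by_contra hle
      have : q.1.2 ^ 2 ≤ q.2.2 ^ 2 := Nat.pow_le_pow_left (not_lt.1 hle) 2
      omega
    rw [Finset.mem_coe]
    simp only [hS, hD, Finset.mem_sigma, Finset.mem_Icc, Finset.mem_product, Finset.mem_filter,
      Finset.mem_range]
    refine ⟨⟨by omega, by omega⟩, ⟨⟨hu', hu⟩, hlt, by trivial⟩, ⟨⟨hv, hv'⟩, hvv, by omega⟩⟩
  · rintro ⟨⟨u, v⟩, ⟨u', v'⟩⟩ _ ⟨⟨w, z⟩, ⟨w', z'⟩⟩ _ h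
    simp only [Sigma.mk.injEq, heq_eq_eq, Prod.mk.injEq] at h
    obtain ⟨_, ⟨rfl, rfl⟩, rfl, rfl⟩ := h
    rfl

/-- COLLISIONS: `#coll ≤ #B + 2 Σ_{1 ≤ m ≤ X} τ(m)²` for points with coordinates `< X` and `u² ≤ X`. [folklore] -/
theorem card_coll_le (B : Finset (ℕ × ℕ)) (X : ℕ) (hB : ∀ b ∈ B, b.1 < X ∧ b.2 < X ∧ b.1 ^ 2 ≤ X) :
    ((B ×ˢ B).filter fun q : (ℕ × ℕ) × (ℕ × ℕ) =>
        q.1.1 ^ 2 + q.1.2 ^ 2 = q.2.1 ^ 2 + q.2.2 ^ 2).card ≤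
      B.card + 2 * ∑ m ∈ Icc 1 X, m.divisors.card ^ 2 := by
  set C := (B ×ˢ B).filter fun q : (ℕ × ℕ) × (ℕ × ℕ) =>
    q.1.1 ^ 2 + q.1.2 ^ 2 = q.2.1 ^ 2 + q.2.2 ^ 2 with hC
  have hsub : C ⊆ (C.filter fun q => q.1.1 = q.2.1) ∪ (C.filter fun q => q.2.1 < q.1.1) ∪
      (C.filter fun q => q.1.1 < q.2.1) := by
    intro q hq
    simp only [Finset.mem_union, Finset.mem_filter]
    rcases lt_trichotomy q.1.1 q.2.1 with h | h | h
    · exact Or.inr ⟨hq, h⟩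
    · exact Or.inl (Or.inl ⟨hq, h⟩)
    · exact Or.inl (Or.inr ⟨hq, h⟩)
  have h0 := Finset.card_le_card hsub
  have h1 := Finset.card_union_le ((C.filter fun q => q.1.1 = q.2.1) ∪ (C.filter fun q => q.2.1 < q.1.1))
    (C.filter fun q => q.1.1 < q.2.1)
  have h2 := Finset.card_union_le (C.filter fun q => q.1.1 = q.2.1) (C.filter fun q => q.2.1 < q.1.1)
  have h3 := card_coll_eq_le B
  have h4 := card_coll_gt_le B X hB
  have h5 := card_coll_lt_le B X hB
  rw [← hC] at h3 h4 h5
  omega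

/-! ### The dyadic box -/

/-- The dyadic parameters: for `n ≥ 8` a box `B = [U₁, U₂) × [0, V)` of lattice points of size exactly `2ⁿ/32`
whose points satisfy `2^{n−1} ≤ u² + v² < 2ⁿ`, `u, v < 2ⁿ` and `u² ≤ 2ⁿ` (even `n = 2k`: with `Q = 2^{k−3}`,
`U₁ = 6Q, U₂ = 7Q, V = 2Q`; odd `n = 2k+1`: `U₁ = 8Q, U₂ = 9Q, V = 4Q`). [folklore] -/
theorem exists_box (n : ℕ) (hn : 8 ≤ n) :
    ∃ B : Finset (ℕ × ℕ), 32 * B.card = 2 ^ n ∧ (∀ b ∈ B, b.1 < 2 ^ n ∧ b.2 < 2 ^ n ∧ b.1 ^ 2 ≤ 2 ^ n) ∧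
      ∀ b ∈ B, 2 ^ (n - 1) ≤ b.1 ^ 2 + b.2 ^ 2 ∧ b.1 ^ 2 + b.2 ^ 2 < 2 ^ n := by
  obtain ⟨k, hk⟩ : ∃ k, n = 2 * k ∨ n = 2 * k + 1 := ⟨n / 2, by omega⟩
  have hk4 : 4 ≤ k := by omega
  obtain ⟨j, rfl⟩ : ∃ j, k = j + 3 := ⟨k - 3, by omega⟩
  set Q : ℕ := 2 ^ j with hQ
  have hQ1 : 1 ≤ Q := Nat.one_le_two_pow
  have h2k : 2 ^ (2 * (j + 3)) = 64 * Q ^ 2 := by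
    rw [hQ, ← pow_mul, show 2 * (j + 3) = 6 + j * 2 by ring, pow_add]; norm_num
  rcases hk with rfl | rfl
  · -- even: X = 64 Q²
    refine ⟨Finset.Ico (6 * Q) (7 * Q) ×ˢ Finset.range (2 * Q), ?_, ?_, ?_⟩
    · rw [Finset.card_product, Nat.card_Ico, Finset.card_range, h2k, show 7 * Q - 6 * Q = Q by omega]
      ring
    · rintro ⟨u, v⟩ hb
      simp only [Finset.mem_product, Finset.mem_Ico, Finset.mem_range] at hb
      obtain ⟨⟨hu1, hu2⟩, hv⟩ := hb
      rw [h2k]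
      have hu2' : u ^ 2 < (7 * Q) ^ 2 := Nat.pow_lt_pow_left hu2 two_ne_zero
      refine ⟨by nlinarith, by nlinarith, by nlinarith⟩
    · rintro ⟨u, v⟩ hb
      simp only [Finset.mem_product, Finset.mem_Ico, Finset.mem_range] at hb
      obtain ⟨⟨hu1, hu2⟩, hv⟩ := hb
      have e1 : 2 ^ (2 * (j + 3) - 1) = 32 * Q ^ 2 := by
        rw [hQ, ← pow_mul, show 2 * (j + 3) - 1 = 5 + j * 2 by omega, pow_add]; norm_num
      rw [e1, h2k]
      have hu1' : (6 * Q) ^ 2 ≤ u ^ 2 := Nat.pow_le_pow_left hu1 2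
      have hu2' : u ^ 2 < (7 * Q) ^ 2 := Nat.pow_lt_pow_left hu2 two_ne_zero
      have hv' : v ^ 2 < (2 * Q) ^ 2 := Nat.pow_lt_pow_left hv two_ne_zero
      constructor <;> nlinarith
  · -- odd: X = 128 Q²
    have h2k1 : 2 ^ (2 * (j + 3) + 1) = 128 * Q ^ 2 := by rw [pow_succ, h2k]; ring
    refine ⟨Finset.Ico (8 * Q) (9 * Q) ×ˢ Finset.range (4 * Q), ?_, ?_, ?_⟩
    · rw [Finset.card_product, Nat.card_Ico, Finset.card_range, h2k1, show 9 * Q - 8 * Q = Q by omega]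
      ring
    · rintro ⟨u, v⟩ hb
      simp only [Finset.mem_product, Finset.mem_Ico, Finset.mem_range] at hb
      obtain ⟨⟨hu1, hu2⟩, hv⟩ := hb
      rw [h2k1]
      have hu2' : u ^ 2 < (9 * Q) ^ 2 := Nat.pow_lt_pow_left hu2 two_ne_zero
      refine ⟨by nlinarith, by nlinarith, by nlinarith⟩
    · rintro ⟨u, v⟩ hb
      simp only [Finset.mem_product, Finset.mem_Ico, Finset.mem_range] at hb
      obtain ⟨⟨hu1, hu2⟩, hv⟩ := hb
      have e1 : 2 ^ (2 * (j + 3) + 1 - 1) = 64 * Q ^ 2 := by rw [Nat.add_sub_cancel, h2k]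
      rw [e1, h2k1]
      have hu1' : (8 * Q) ^ 2 ≤ u ^ 2 := Nat.pow_le_pow_left hu1 2
      have hu2' : u ^ 2 < (9 * Q) ^ 2 := Nat.pow_lt_pow_left hu2 two_ne_zero
      have hv' : v ^ 2 < (4 * Q) ^ 2 := Nat.pow_lt_pow_left hv two_ne_zero
      constructor <;> nlinarith

/-! ### The theorem -/

/-- **`TwoSquaresFloor`** (stmt-QuantumAdvantage-16062): `#(S₂ ∩ [2^{n−1}, 2ⁿ)) ≥ 2ⁿ/(3072 n³)` for all `n ≥ 8`.
[Landau 1908 (much stronger); elementary second-moment proof] [folklore] -/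
theorem twoSquaresFloor_proof :
    Summit.QuantumAdvantage.QuantumAdvantage.Theses.TwoSquaresLadder.TwoSquaresFloor := by
  unfold Summit.QuantumAdvantage.QuantumAdvantage.Theses.TwoSquaresLadder.TwoSquaresFloor
  refine ⟨1 / 3072, by norm_num, ?_⟩
  rw [Filter.eventually_atTop]
  refine ⟨8, fun n hn => ?_⟩
  classical
  obtain ⟨B, hcard, hbnd, hmem⟩ := exists_box n hn
  set X : ℕ := 2 ^ n with hX
  -- the box maps into `S₂ ∩ [X/2, X)`
  have himage : (B.image fun b : ℕ × ℕ => b.1 ^ 2 + b.2 ^ 2) ⊆ (Finset.Ico (2 ^ (n - 1)) (2 ^ n)).filter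
      (fun N => ∃ u v : ℕ, N = u ^ 2 + v ^ 2) := by
    intro N hN
    rw [Finset.mem_image] at hN
    obtain ⟨⟨u, v⟩, hb, rfl⟩ := hN
    rw [Finset.mem_filter, Finset.mem_Ico]
    exact ⟨hmem _ hb, u, v, rfl⟩
  -- real-number sizes
  have hXpos : (0 : ℝ) < X := by positivity
  have hn' : (8 : ℝ) ≤ n := by exact_mod_cast hn
  have hBcard : (B.card : ℝ) = X / 32 := by
    have : (32 : ℝ) * B.card = X := by exact_mod_cast hcard
    linarith
  -- `Σ τ² ≤ X n³`
  have hH := Literature.NumberTheory.Sieve.FriedlanderIwaniecPrimes.sum_Icc_one_div_le X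
  have hlog : Real.log X = n * Real.log 2 := by
    rw [hX, Nat.cast_pow, Real.log_pow]; norm_num
  have hlog2 : Real.log 2 < 0.6932 := Real.log_two_lt_d9.trans (by norm_num)
  have hHn : ∑ k ∈ Icc 1 X, (1 : ℝ) / k ≤ n := by
    rw [hlog] at hH
    nlinarith
  have hT : ∑ m ∈ Icc 1 X, ((m.divisors.card ^ 2 : ℕ) : ℝ) ≤ (X : ℝ) * (n : ℝ) ^ 3 :=
    (sum_tau_sq_le X).trans (mul_le_mul_of_nonneg_left
      (pow_le_pow_left₀ (Finset.sum_nonneg fun _ _ => by positivity) hHn 3) hXpos.le)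
  -- collisions `≤ 3 X n³`
  have hcoll := card_coll_le B X hbnd
  have hcollR : ((((B ×ˢ B).filter fun q : (ℕ × ℕ) × (ℕ × ℕ) =>
      q.1.1 ^ 2 + q.1.2 ^ 2 = q.2.1 ^ 2 + q.2.2 ^ 2).card : ℝ)) ≤ 3 * X * (n : ℝ) ^ 3 := by
    have h1 : ((((B ×ˢ B).filter fun q : (ℕ × ℕ) × (ℕ × ℕ) =>
        q.1.1 ^ 2 + q.1.2 ^ 2 = q.2.1 ^ 2 + q.2.2 ^ 2).card : ℝ)) ≤
        B.card + 2 * ∑ m ∈ Icc 1 X, ((m.divisors.card ^ 2 : ℕ) : ℝ) := by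
      exact_mod_cast hcoll
    have h3 : (1 : ℝ) ≤ (n : ℝ) ^ 3 := one_le_pow₀ (by linarith)
    rw [hBcard] at h1
    nlinarith
  -- Cauchy–Schwarz and the conclusion
  have hCS := card_sq_le_image_mul_coll B
  set A := B.image fun b : ℕ × ℕ => b.1 ^ 2 + b.2 ^ 2 with hA
  have hAcard : (A.card : ℝ) ≤ (((Finset.Ico (2 ^ (n - 1)) (2 ^ n)).filter
      (fun N => ∃ u v : ℕ, N = u ^ 2 + v ^ 2)).card : ℝ) := by
    exact_mod_cast Finset.card_le_card himage
  have hn3 : (0 : ℝ) < (n : ℝ) ^ 3 := by positivity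
  have hApos : (X : ℝ) / 3072 / (n : ℝ) ^ 3 ≤ (A.card : ℝ) := by
    have h1 : ((X : ℝ) / 32) ^ 2 ≤ (A.card : ℝ) * (3 * X * (n : ℝ) ^ 3) := by
      calc ((X : ℝ) / 32) ^ 2 = (B.card : ℝ) ^ 2 := by rw [hBcard]
        _ ≤ (A.card : ℝ) * _ := hCS
        _ ≤ (A.card : ℝ) * (3 * X * (n : ℝ) ^ 3) := mul_le_mul_of_nonneg_left hcollR (Nat.cast_nonneg _)
    rw [div_div, div_le_iff₀ (by positivity)]
    nlinarith
  calc 1 / 3072 * (2 : ℝ) ^ n / (n : ℝ) ^ 3 = (X : ℝ) / 3072 / (n : ℝ) ^ 3 := by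
        rw [hX]; push_cast; ring
    _ ≤ (A.card : ℝ) := hApos
    _ ≤ _ := hAcard

end Summit.QuantumAdvantage.QuantumAdvantage.Theorems.TwoSquaresFloor
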